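import Literature.MathematicalPhysics.QuantumLattice.PeriodicLayeredLatticeDimerDressedTransport
import Literature.MathematicalPhysics.QuantumLattice.SpinSectorPartitionFnParticleHole
import HarnessLib

/-!
# The U-dressed interlayer floor with BOTH vertical bond classes dressed: intra- and inter-bilayer bonds
# are each a set of disjoint Hubbard dimers, `e_ρ(U − W₁ − W₂) + ½(a₁ + 2b₁ρ) + ½(a₂ + 2b₂ρ) ≤ inf e(bilayer crystal)`

Topic `Literature/MathematicalPhysics/QuantumLattice` (namespace = path; family `hubbard`). Sequel of
`PeriodicLayeredLatticeDimerDressedTransport.lean` (the intra-bilayer class `t⊥` dressed by the dimer `h_{2×1}(t⊥, 0, W₁)`, the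
inter-bilayer class `t⊥'` kept kinematic, `−|t⊥'|`). Here the inter-bilayer class is dressed as well: for a period-`2`
periodic state `ω`, the inter-bilayer pattern read in `ω` IS the intra-bilayer pattern read in the translated state
`ω ∘ τ_{e₀}` (the coset label moves by one layer; `ω ∘ τ_{2e₀} = ω`), and `ω ∘ τ_{e₀}` has the same cell filling and the same
cell-averaged double occupancy, so the dressed dimer row of the parent applies to it verbatim. The S1 records of bilayer
cuprates print ONE interlayer row, so the seam only knows `|t⊥'| ≤ |t⊥|`; with both classes dressed the allowance of that
untyped bond drops from `|t⊥|` to `|t⊥|·A(V₂, ρ)` as well (e.g. YBa₂Cu₃O₇, `t⊥ ≤ 0.45`: `0.45 → 0.20` at `V₂ = 4`).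

* §1 the sign of the hopping is immaterial on OPEN boxes (bipartite for all sides; stagger lemmas `rectStagger_eq_neg_of_boxAdj` /
  `rectStagger_eq_of_boxDiagAdj` of `SpinSectorPartitionFnParticleHole`): `groundEnergy_hubbardOpenBoxTT'_particleHole` (`E_{t,t',U}(2ab − N) = E_{t,−t',U}(N) − UN + Uab`),
  `groundEnergy_hubbardOpenBoxTT'_particleHole_uniform`, **`groundEnergy_hubbardOpenBoxTT'_neg_t`** (`E_{−t,t',U}(N) = E_{t,t',U}(N)`),
  and `dimer_rows_abs` (unit rows at `V` ⇒ rows `|s|·(a + bk) ≤ E₀(h_{2×1}(s, 0, |s|V), k)` for EVERY sign of `s`).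
* §2 period-2 translates: `sublatticeVectorHopping_label_congr`, `IsPeriodic.shift_two_unitVec` (`ω ∘ τ_{2e₀} = ω`),
  `IsPeriodic.cellEnergy_interPattern_eq_intraPattern_shift` (`K⊥'(ω) = K⊥(ω ∘ τ_{e₀})`), `IsPeriodic.cellEnergy_const_shift`,
  `IsPeriodic.cellFilling_shift` — and the inter-class dressed row `IsPeriodic.mul_cellEnergy_onSite_add_mul_cellEnergy_interPattern_ge`.
* §3 THE TWO-DIMER FLOOR: `IsPeriodic.le_cellEnergy_periodicLayeredViews_twoDimer`, **`le_infCellEnergyOn_periodicLayeredViews_twoDimer`**,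
  **`le_infCellEnergyOn_bilayerHubbardTTPrime_twoDimer{,_openBox,_unitRows}`** — unit-rows form:
  `energyDensityTT' t t' (U − V₁|t⊥| − V₂|t⊥'|) ρ + |t⊥|·(a₁/2 + b₁ρ) + |t⊥'|·(a₂/2 + b₂ρ) ≤ inf_{periodic, filling ρ} e(bilayer crystal)`.

Everything is PROVED; no definition, no named fact, no number. HONEST SCOPE: energy words only (variational cell energies over the
period-2 periodic class); floor side only; the price of reading the in-plane floor `V₁|t⊥| + V₂|t⊥'|` lower in `U` is the consumer's.

## Tree / Mathlib search

REUSED: everything of `PeriodicLayeredLatticeDimerDressedTransport` / `…BilayerCell`; `rectStagger`, `card_rectSites`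
(`HubbardNNNHoppingRectSymmetries`, `HubbardRectangularTorus`); `rectStagger_eq_neg_of_boxAdj`, `rectStagger_eq_of_boxDiagAdj`
(`SpinSectorPartitionFnParticleHole`, the partition-function twin of §1); `hamiltonian_particleHole_bipartite_holds`, `hamiltonian_particleHole_sameSign`,
`groundEnergy_particleHole_transfer` (`HubbardModelParticleHoleProofs`, `HubbardNNNHoppingParticleHole`); `periodVec`, `IsPeriodic`, `shift_shift`
(`PeriodicStatesCellAverage`, `InfVolFermionState`). Mathlib: `abs_of_nonneg`, `abs_of_neg`.
`lean search 'OpenBox.*neg_t|interPattern|twoDimer' --decl`: nothing of this kind (the torus twin `groundEnergy_hubbardRectTorusTT'_neg_t` needs even sides).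

## References

* P. W. Anderson, Phys. Rev. 83 (1951) 1260, eq. (2). [cite: Anderson1951, eq. (2)]
* E. H. Lieb, F. Y. Wu, Physica A 321 (2003) 1, §1 eq. (3) (particle–hole transfer of sector energies). [cite: LiebWuPhysicaA2003, §1 eq. (3)]
* F. H. L. Essler et al., *The One-Dimensional Hubbard Model* (2005), §2.2.4 eqs. (2.59)–(2.61). [cite: EsslerEtAl2005, §2.2.4 eqs. (2.59)–(2.61)]
* H. Araki, H. Moriya, Rev. Math. Phys. 15 (2003) 93, §4.1. [cite: ArakiMoriya2003, §4.1]
* O. Bratteli, A. Kishimoto, D. W. Robinson, CMP 64 (1978) 41, Thm. 2. [cite: BratteliKishimotoRobinson1978, Thm. 2 (condition 2)]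
-/

noncomputable section

namespace Literature.MathematicalPhysics.QuantumLattice

open Matrix Finset HubbardWave0 Literature.Probability.LatticeModels ThermodynamicLimit
open scoped ComplexOrder BigOperators

/-! ### §1. The sign of the hopping is immaterial on open boxes -/

section OpenBoxSign

variable {a b : ℕ}

/-- **Staggered particle–hole symmetry of the open-cluster `t–t'` sector energies**: for every `a, b`, `N ≤ 2ab`,
`E_{t,t',U}(2ab − N) = E_{t,−t',U}(N) − UN + Uab`. [cite: LiebWuPhysicaA2003, §1 eq. (3)] -/
theorem groundEnergy_hubbardOpenBoxTT'_particleHole (a b : ℕ) (t t' U : ℝ) {N : ℕ} (hN : N ≤ 2 * (a * b)) :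
    groundEnergy (hubbardOpenBoxTT' a b t t' U) (2 * (a * b) - N) =
      groundEnergy (hubbardOpenBoxTT' a b t (-t') U) N - U * N + U * (a * b) := by
  have hcard : Fintype.card (Fin a ×ₗ Fin b) = a * b := card_rectSites a b
  have hn : ∀ i : Orb (Fin a ×ₗ Fin b), ‖((rectStagger a b (ofLex i).1 : ℤ) : ℂ)‖ = 1 :=
    fun i => norm_intCast_units _
  have hNN := hamiltonian_particleHole_bipartite_holds (rectBoxGraph a b) t U
    (rectStagger a b) (fun x y hxy => rectStagger_eq_neg_of_boxAdj hxy)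
  have hNNN := hamiltonian_particleHole_sameSign (rectBoxDiagGraph a b) t' 0
    (rectStagger a b) (fun x y hxy => rectStagger_eq_of_boxDiagAdj hxy)
  have key := congrArg₂ (· + ·) hNN hNNN
  simp only [zero_mul, Complex.ofReal_zero, zero_smul, sub_zero, add_zero] at key
  rw [← Matrix.add_mul, ← Matrix.mul_add, ← hubbardOpenBoxTT', add_right_comm,
    sub_add_eq_add_sub, ← hubbardOpenBoxTT'] at key
  have h := groundEnergy_particleHole_transfer _ hn key (N := N) (by rw [hcard]; exact hN)
  rw [hcard] at h
  rw [h]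
  push_cast
  ring

/-- **Uniform-sign particle–hole conjugation of the open-cluster `t–t'` sector energies**: for every `a, b`, `N ≤ 2ab`,
`E_{t,t',U}(2ab − N) = E_{−t,−t',U}(N) − UN + Uab`. [cite: EsslerEtAl2005, §2.2.4 eqs. (2.59)–(2.61)] -/
theorem groundEnergy_hubbardOpenBoxTT'_particleHole_uniform (a b : ℕ) (t t' U : ℝ) {N : ℕ} (hN : N ≤ 2 * (a * b)) :
    groundEnergy (hubbardOpenBoxTT' a b t t' U) (2 * (a * b) - N) =
      groundEnergy (hubbardOpenBoxTT' a b (-t) (-t') U) N - U * N + U * (a * b) := by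
  have hcard : Fintype.card (Fin a ×ₗ Fin b) = a * b := card_rectSites a b
  have hn : ∀ i : Orb (Fin a ×ₗ Fin b), ‖(((fun _ : Fin a ×ₗ Fin b => (1 : ℤˣ)) (ofLex i).1 : ℤ) : ℂ)‖ = 1 :=
    fun i => norm_intCast_units _
  have hNN := hamiltonian_particleHole_sameSign (rectBoxGraph a b) t U (fun _ => (1 : ℤˣ)) (fun _ _ _ => rfl)
  have hNNN := hamiltonian_particleHole_sameSign (rectBoxDiagGraph a b) t' 0 (fun _ => (1 : ℤˣ)) (fun _ _ _ => rfl)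
  have key := congrArg₂ (· + ·) hNN hNNN
  simp only [zero_mul, Complex.ofReal_zero, zero_smul, sub_zero, add_zero] at key
  rw [← Matrix.add_mul, ← Matrix.mul_add, ← hubbardOpenBoxTT', add_right_comm,
    sub_add_eq_add_sub, ← hubbardOpenBoxTT'] at key
  have h := groundEnergy_particleHole_transfer _ hn key (N := N) (by rw [hcard]; exact hN)
  rw [hcard] at h
  rw [h]
  push_cast
  ring

/-- **The sign of the nearest-neighbour hopping is immaterial on every open box** (bipartite gauge
`c_{xσ} ↦ (−1)^{x₁+x₂} c_{xσ}` = staggered ∘ uniform particle–hole conjugation): `E_{−t,t',U}(N) = E_{t,t',U}(N)`, `N ≤ 2ab`.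
[cite: LiebPRL1989, Theorem 2 (bipartite lattice)] -/
theorem groundEnergy_hubbardOpenBoxTT'_neg_t (a b : ℕ) (t t' U : ℝ) {N : ℕ} (hN : N ≤ 2 * (a * b)) :
    groundEnergy (hubbardOpenBoxTT' a b (-t) t' U) N = groundEnergy (hubbardOpenBoxTT' a b t t' U) N := by
  have h1 := groundEnergy_hubbardOpenBoxTT'_particleHole a b t (-t') U hN
  have h2 := groundEnergy_hubbardOpenBoxTT'_particleHole_uniform a b t (-t') U hN
  rw [neg_neg] at h1 h2
  linarith

/-- **Unit-hopping dimer rows serve every SIGNED amplitude**: rows `a + b k ≤ E₀(h_{2×1}(1, 0, V), k)` (`k ≤ 4`) give, for every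
real `s`, `|s|·a + |s|·b·k ≤ E₀(h_{2×1}(s, 0, |s|·V), k)`. [cite: LiebPRL1989, Theorem 2 (bipartite lattice)] -/
theorem dimer_rows_abs {a b V : ℝ} (s : ℝ)
    (hrow : ∀ k : ℕ, k ≤ 4 → a + b * k ≤ groundEnergy (hubbardOpenBoxTT' 2 1 1 0 V) k) :
    ∀ k : ℕ, k ≤ 4 → |s| * a + |s| * b * k ≤ groundEnergy (hubbardOpenBoxTT' 2 1 s 0 (|s| * V)) k := by
  intro k hk
  have h := dimer_rows_smul (abs_nonneg s) hrow k hk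
  rcases le_or_gt 0 s with hs | hs
  · rwa [abs_of_nonneg hs] at h ⊢
  · have hk' : k ≤ 2 * (2 * 1) := by omega
    rw [abs_of_neg hs] at h ⊢
    have h2 := groundEnergy_hubbardOpenBoxTT'_neg_t 2 1 (-s) 0 (-s * V) hk'
    rw [neg_neg] at h2
    rw [h2]
    exact h

end OpenBoxSign

/-! ### §2. Period-2 translates: the inter-bilayer pattern is the intra-bilayer pattern of the translated state -/

section Translates

variable {d : ℕ}

/-- Sublattice-selective hoppings with the same coset are the same interaction. [cite: ArakiMoriya2003, §4.1] -/
theorem sublatticeVectorHopping_label_congr {q : Fin d → ℕ} {c c' : Site d} (h : ∀ x, InCoset q c x ↔ InCoset q c' x)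
    (v : Site d) (t : ℝ) : sublatticeVectorHopping q c v t = sublatticeVectorHopping q c' v t := by
  refine FermionInteraction.ext fun X => ?_
  simp only [sublatticeVectorHopping, h]

/-- In the period-2 stacking, the layer cosets of `e₀` and `−e₀` coincide (both = the odd layers). [cite: ArakiMoriya2003, §4.1] -/
theorem inCoset_stack_unitVec_iff_neg (x : Site (d + 1)) :
    InCoset (stackPeriods d 1) (unitVec 0) x ↔ InCoset (stackPeriods d 1) (-unitVec 0) x := by
  rw [inCoset_stackPeriods_one_iff, inCoset_stackPeriods_one_iff]
  simp only [unitVec, Pi.neg_apply, Pi.single_eq_same]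
  omega

/-- The layer-`1` coset representative is `e₀`. [cite: ArakiMoriya2003, §4.1] -/
theorem layerCoset_one_eq (d : ℕ) : layerCoset d 1 = unitVec 0 := by
  funext i
  refine Fin.cases ?_ (fun j => ?_) i
  · simp [layerCoset, unitVec]
  · simp [layerCoset, unitVec, Fin.succ_ne_zero]

/-- **A period-2 state is invariant under two layer steps**: `ω ∘ τ_{2e₀} = ω`. [cite: ArakiMoriya2003, §4.1 Def. 4.5] -/
theorem InfVolFermionState.IsPeriodic.shift_two_unitVec {ω : InfVolFermionState (d + 1)}
    (hω : ω.IsPeriodic (stackPeriods d 1)) : ω.shift (unitVec 0 + unitVec 0) = ω := by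
  have hP : (unitVec 0 : Site (d + 1)) + unitVec 0 = periodVec (stackPeriods d 1) 0 := by
    funext i
    refine Fin.cases ?_ (fun j => ?_) i
    · simp [periodVec, unitVec, stackPeriods]
    · simp [periodVec, unitVec, Fin.succ_ne_zero]
  rw [hP]
  exact hω 0

/-- **THE INTER-BILAYER PATTERN IS THE INTRA-BILAYER PATTERN OF THE TRANSLATED STATE**: for a period-2 state,
`K⊥'(ω) = K⊥(ω ∘ τ_{e₀})` (unit amplitudes; any range). [cite: ArakiMoriya2003, §4.1] -/
theorem InfVolFermionState.IsPeriodic.cellEnergy_interPattern_eq_intraPattern_shift {ω : InfVolFermionState (d + 1)}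
    (hω : ω.IsPeriodic (stackPeriods d 1)) (R : ℝ) :
    ω.cellEnergy (sublatticeVectorHoppingViews (stackPeriods d 1) (layerCoset d 1) (unitVec 0) 1) R =
      (ω.shift (unitVec 0)).cellEnergy (sublatticeVectorHoppingViews (stackPeriods d 1) (layerCoset d 0) (unitVec 0) 1) R := by
  obtain ⟨c₀, c₁, hne, huniv, h0, h1⟩ := exists_stackCells_two (d := d)
  rw [InfVolFermionState.cellEnergy, InfVolFermionState.cellEnergy, huniv, Finset.sum_pair hne, Finset.sum_pair hne]
  simp only [sublatticeVectorHoppingViews]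
  rw [h0, h1, InfVolFermionState.shift_zero, InfVolFermionState.shift_zero, InfVolFermionState.shift_shift,
    hω.shift_two_unitVec, layerCoset_one_eq, layerCoset_zero_eq, sub_zero, sub_zero, sub_self, zero_sub,
    sublatticeVectorHopping_label_congr (inCoset_stack_unitVec_iff_neg (d := d)) (unitVec 0) 1]
  ring

/-- The cell energy of constant views is invariant under the layer step for period-2 states. [cite: ArakiMoriya2003, §4.1] -/
theorem InfVolFermionState.IsPeriodic.cellEnergy_const_shift {ω : InfVolFermionState (d + 1)}
    (hω : ω.IsPeriodic (stackPeriods d 1)) (Ψ : FermionInteraction (d + 1)) (R : ℝ) :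
    (ω.shift (unitVec 0)).cellEnergy (fun _ : Cell (stackPeriods d 1) => Ψ) R =
      ω.cellEnergy (fun _ : Cell (stackPeriods d 1) => Ψ) R := by
  rw [InfVolFermionState.cellEnergy_const_stack_two, InfVolFermionState.cellEnergy_const_stack_two,
    InfVolFermionState.shift_shift, hω.shift_two_unitVec]
  ring

/-- The cell filling is invariant under the layer step for period-2 states. [cite: ArakiMoriya2003, §4.1] -/
theorem InfVolFermionState.IsPeriodic.cellFilling_shift {ω : InfVolFermionState (d + 1)}
    (hω : ω.IsPeriodic (stackPeriods d 1)) :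
    (ω.shift (unitVec 0)).cellFilling (stackPeriods d 1) = ω.cellFilling (stackPeriods d 1) := by
  rw [InfVolFermionState.cellFilling_stack_two, InfVolFermionState.cellFilling_stack_two,
    InfVolFermionState.shift_shift, hω.shift_two_unitVec]
  ring

/-- **THE DRESSED DIMER ROW FOR THE INTER-BILAYER CLASS**: for a period-2 state `ω` and rows
`a + b·k ≤ E₀(h_dimer(s, W), k)` (`k ≤ 4`, rows on `groundEnergyAt (polyGraph {0, 0 + e₀}) s W`):
`½(a + 2b·ρ̄(ω)) ≤ W·D̄(ω) + s·K⊥'(ω)`. [cite: Anderson1951, eq. (2)] -/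
theorem InfVolFermionState.IsPeriodic.mul_cellEnergy_onSite_add_mul_cellEnergy_interPattern_ge
    {ω : InfVolFermionState (d + 1)} (hω : ω.IsPeriodic (stackPeriods d 1)) (s W : ℝ) {R : ℝ} (hR : 1 ≤ R) {a b : ℝ}
    (hrow : ∀ k : ℕ, k ≤ 4 → a + b * k ≤ groundEnergyAt (polyGraph ({0, 0 + unitVec 0} : Finset (Site (d + 1)))) s W k) :
    2⁻¹ * (a + 2 * b * ω.cellFilling (stackPeriods d 1)) ≤
      W * ω.cellEnergy (fun _ : Cell (stackPeriods d 1) => hubbardFermionInteraction (d + 1) 0 1) R +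
        s * ω.cellEnergy (sublatticeVectorHoppingViews (stackPeriods d 1) (layerCoset d 1) (unitVec 0) 1) R := by
  have h := (ω.shift (unitVec 0)).mul_cellEnergy_onSite_add_mul_cellEnergy_intraPattern_ge s W hR hrow
  rwa [hω.cellFilling_shift, hω.cellEnergy_const_shift, ← hω.cellEnergy_interPattern_eq_intraPattern_shift] at h

end Translates

/-! ### §3. THE TWO-DIMER DRESSED FLOOR -/

section Floor

variable {d : ℕ} {ι : Type*} [Fintype ι]

/-- **THE TWO-DIMER FLOOR FOR EVERY PERIOD-2 STATE**: with dimer rows `(a₁, b₁)` at `(t⊥, W₁)` and `(a₂, b₂)` at `(t⊥', W₂)`,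
`e_ρ(one-band, U − W₁ − W₂) + ½(a₁ + 2b₁ρ) + ½(a₂ + 2b₂ρ) ≤ e_cell(ω)` for every `(2, 1, …, 1)`-periodic `ω` of cell filling `ρ`.
[cite: Anderson1951, eq. (2)] -/
theorem InfVolFermionState.IsPeriodic.le_cellEnergy_periodicLayeredViews_twoDimer {ω : InfVolFermionState (d + 1)}
    (hω : ω.IsPeriodic (stackPeriods d 1)) {ρ : ℝ} (hρ : ω.cellFilling (stackPeriods d 1) = ρ) (U W₁ W₂ : ℝ)
    {u : ι → Site d} (hu : ∀ a, u a ≠ 0) (θ : ι → ℝ) (tperp tperp' : ℝ) {R R' : ℝ} (hR : 1 ≤ R) (hRR' : R ≤ R')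
    (huR : ∀ a, u a ∈ thicken ({0} : Finset (Site d)) R) {a₁ b₁ a₂ b₂ : ℝ}
    (hrow₁ : ∀ k : ℕ, k ≤ 4 → a₁ + b₁ * k ≤ groundEnergyAt (polyGraph ({0, 0 + unitVec 0} : Finset (Site (d + 1)))) tperp W₁ k)
    (hrow₂ : ∀ k : ℕ, k ≤ 4 → a₂ + b₂ * k ≤ groundEnergyAt (polyGraph ({0, 0 + unitVec 0} : Finset (Site (d + 1)))) tperp' W₂ k) :
    (vectorHoppingModel (U - W₁ - W₂) u θ).tiGroundEnergyDensityAt R ρ + 2⁻¹ * (a₁ + 2 * b₁ * ρ) + 2⁻¹ * (a₂ + 2 * b₂ * ρ) ≤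
      ω.cellEnergy (periodicLayeredViews 1 U u θ (fun _ : Fin 1 => (unitVec (0 : Fin (d + 1)) : Site (d + 1)))
        fun j _ => ![tperp, tperp'] j) R' := by
  have hR' : 1 ≤ R' := hR.trans hRR'
  have hw : (unitVec (0 : Fin (d + 1)) : Site (d + 1)) ≠ 0 := uvec_ne_zero 0
  have hwR' : (unitVec (0 : Fin (d + 1)) : Site (d + 1)) ∈ thicken ({0} : Finset (Site (d + 1))) R' :=
    thicken_mono _ hR' (unitVec_mem_thicken_one 0)
  -- (1) the in-plane floor at `U − W₁ − W₂`
  have hin := hω.tiGroundEnergyDensityAt_sub_le_cellEnergy_periodicLayeredViews hρ (U - W₁ - W₂) hu θ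
    (w := fun _ : Fin 1 => (unitVec (0 : Fin (d + 1)) : Site (d + 1))) (fun _ => hw) (fun _ _ => (0 : ℝ)) hR hRR' huR
    (fun _ => hwR')
  rw [periodicLayeredViews, InfVolFermionState.cellEnergy_viewFamily] at hin
  simp only [abs_zero, Finset.sum_const_zero, mul_zero, sub_zero, zero_mul, add_zero] at hin
  -- (2) expansion at `U` and the `U`-split by `W₁ + W₂`
  have hsum : ∑ jb : Fin (1 + 1) × Fin 1, (fun j (_ : Fin 1) => (![tperp, tperp'] : Fin (1 + 1) → ℝ) j) jb.1 jb.2 *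
      ω.cellEnergy (sublatticeVectorHoppingViews (stackPeriods d 1) (layerCoset d jb.1)
        ((fun _ : Fin 1 => (unitVec (0 : Fin (d + 1)) : Site (d + 1))) jb.2) 1) R' =
      tperp * ω.cellEnergy (sublatticeVectorHoppingViews (stackPeriods d 1) (layerCoset d 0) (unitVec 0) 1) R' +
        tperp' * ω.cellEnergy (sublatticeVectorHoppingViews (stackPeriods d 1) (layerCoset d 1) (unitVec 0) 1) R' := by
    rw [Fintype.sum_prod_type]
    simp [Fin.sum_univ_two]
  rw [periodicLayeredViews, InfVolFermionState.cellEnergy_viewFamily, hsum,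
    ω.cellEnergy_inPlaneModel_eq_sub_add U (W₁ + W₂) u θ hR', show U - (W₁ + W₂) = U - W₁ - W₂ by ring]
  -- (3) the two dressed rows
  have hd₁ := ω.mul_cellEnergy_onSite_add_mul_cellEnergy_intraPattern_ge tperp W₁ hR' hrow₁
  have hd₂ := hω.mul_cellEnergy_onSite_add_mul_cellEnergy_interPattern_ge tperp' W₂ hR' hrow₂
  rw [hρ] at hd₁ hd₂
  linarith

/-- **THE TWO-DIMER FLOOR (class infimum)**, general in-plane one-band model on `ℤ^d` (`0 < d`, `ρ` realised by a
translation-invariant state of `ℤ^d`). [cite: BratteliKishimotoRobinson1978, Thm. 2 (condition 2)] -/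
theorem le_infCellEnergyOn_periodicLayeredViews_twoDimer (hd : 0 < d) {ρ : ℝ}
    (hne : ∃ ω₀ : InfVolFermionState d, ω₀.IsTranslationInvariant ∧ ω₀.density = ρ) (U W₁ W₂ : ℝ)
    {u : ι → Site d} (hu : ∀ a, u a ≠ 0) (θ : ι → ℝ) (tperp tperp' : ℝ) {R R' : ℝ} (hR : 1 ≤ R) (hRR' : R ≤ R')
    (huR : ∀ a, u a ∈ thicken ({0} : Finset (Site d)) R) {a₁ b₁ a₂ b₂ : ℝ}
    (hrow₁ : ∀ k : ℕ, k ≤ 4 → a₁ + b₁ * k ≤ groundEnergyAt (polyGraph ({0, 0 + unitVec 0} : Finset (Site (d + 1)))) tperp W₁ k)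
    (hrow₂ : ∀ k : ℕ, k ≤ 4 → a₂ + b₂ * k ≤ groundEnergyAt (polyGraph ({0, 0 + unitVec 0} : Finset (Site (d + 1)))) tperp' W₂ k) :
    (vectorHoppingModel (U - W₁ - W₂) u θ).tiGroundEnergyDensityAt R ρ + 2⁻¹ * (a₁ + 2 * b₁ * ρ) + 2⁻¹ * (a₂ + 2 * b₂ * ρ) ≤
      infCellEnergyOn (periodicStatesAt (stackPeriods d 1) ρ)
        (periodicLayeredViews 1 U u θ (fun _ : Fin 1 => (unitVec (0 : Fin (d + 1)) : Site (d + 1)))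
          fun j _ => ![tperp, tperp'] j) R' := by
  obtain ⟨ω₀, hω₀, hρ₀⟩ := hne
  have he := hω₀.isEven hd
  have hTI := InfVolFermionState.stack_isTranslationInvariant hω₀ he
  have hmem : ω₀.stack he ∈ periodicStatesAt (stackPeriods d 1) ρ :=
    ⟨hTI.isPeriodic _, by rw [hTI.cellFilling_eq, InfVolFermionState.density_stack, hρ₀]⟩
  exact le_infCellEnergyOn _ R' ⟨_, hmem⟩ fun ω hω =>
    hω.1.le_cellEnergy_periodicLayeredViews_twoDimer hω.2 U W₁ W₂ hu θ tperp tperp' hR hRR' huR hrow₁ hrow₂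

/-- **THE TWO-DIMER FLOOR FOR BILAYER `t–t'` HUBBARD CRYSTALS on `ℤ³`** (`0 ≤ U − W₁ − W₂`, `0 < ρ < 2`):
`energyDensityTT' t t' (U − W₁ − W₂) ρ + (a₁/2 + b₁ρ) + (a₂/2 + b₂ρ) ≤ inf_{periodic, cell filling ρ} e(bilayer crystal)`.
[cite: BratteliKishimotoRobinson1978, Thm. 2 (condition 2)] -/
theorem le_infCellEnergyOn_bilayerHubbardTTPrime_twoDimer (t t' : ℝ) {U W₁ W₂ : ℝ} (hUW : 0 ≤ U - W₁ - W₂) {ρ : ℝ}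
    (hρ0 : 0 < ρ) (hρ2 : ρ < 2) (tperp tperp' : ℝ) {a₁ b₁ a₂ b₂ : ℝ}
    (hrow₁ : ∀ k : ℕ, k ≤ 4 → a₁ + b₁ * k ≤ groundEnergyAt (polyGraph ({0, 0 + unitVec 0} : Finset (Site 3))) tperp W₁ k)
    (hrow₂ : ∀ k : ℕ, k ≤ 4 → a₂ + b₂ * k ≤ groundEnergyAt (polyGraph ({0, 0 + unitVec 0} : Finset (Site 3))) tperp' W₂ k) :
    energyDensityTT' t t' (U - W₁ - W₂) ρ + 2⁻¹ * (a₁ + 2 * b₁ * ρ) + 2⁻¹ * (a₂ + 2 * b₂ * ρ) ≤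
      infCellEnergyOn (periodicStatesAt (stackPeriods 2 1) ρ)
        (periodicLayeredHubbardTTPrimeViews 1 t t' U (fun _ : Fin 1 => (unitVec (0 : Fin 3) : Site 3))
          fun j _ => ![tperp, tperp'] j) 1 := by
  rw [← tiGroundEnergyDensityAt_hubbardTTPrime_eq_energyDensityTT' t t' hUW hρ0 hρ2,
    hubbardTTPrimeFermionInteraction_eq_vectorHoppingModel]
  exact le_infCellEnergyOn_periodicLayeredViews_twoDimer two_pos (exists_isTranslationInvariant_density_eq hρ0 hρ2) U W₁ W₂
    ttPrimeVec_ne_zero (ttPrimeAmp t t') tperp tperp' le_rfl le_rfl ttPrimeVec_mem_thicken_one hrow₁ hrow₂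

/-- **THE TWO-DIMER FLOOR, rows on the open `2 × 1` cluster.** [cite: Anderson1951, eq. (2)] -/
theorem le_infCellEnergyOn_bilayerHubbardTTPrime_twoDimer_openBox (t t' : ℝ) {U W₁ W₂ : ℝ} (hUW : 0 ≤ U - W₁ - W₂) {ρ : ℝ}
    (hρ0 : 0 < ρ) (hρ2 : ρ < 2) (tperp tperp' : ℝ) {a₁ b₁ a₂ b₂ : ℝ}
    (hrow₁ : ∀ k : ℕ, k ≤ 4 → a₁ + b₁ * k ≤ groundEnergy (hubbardOpenBoxTT' 2 1 tperp 0 W₁) k)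
    (hrow₂ : ∀ k : ℕ, k ≤ 4 → a₂ + b₂ * k ≤ groundEnergy (hubbardOpenBoxTT' 2 1 tperp' 0 W₂) k) :
    energyDensityTT' t t' (U - W₁ - W₂) ρ + 2⁻¹ * (a₁ + 2 * b₁ * ρ) + 2⁻¹ * (a₂ + 2 * b₂ * ρ) ≤
      infCellEnergyOn (periodicStatesAt (stackPeriods 2 1) ρ)
        (periodicLayeredHubbardTTPrimeViews 1 t t' U (fun _ : Fin 1 => (unitVec (0 : Fin 3) : Site 3))
          fun j _ => ![tperp, tperp'] j) 1 :=
  le_infCellEnergyOn_bilayerHubbardTTPrime_twoDimer t t' hUW hρ0 hρ2 tperp tperp'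
    (fun k hk => by rw [groundEnergyAt_polyGraph_pair_eq_openBox]; exact hrow₁ k hk)
    (fun k hk => by rw [groundEnergyAt_polyGraph_pair_eq_openBox]; exact hrow₂ k hk)

/-- **THE TWO-DIMER FLOOR from unit-hopping dimer tables, every sign of the amplitudes**: for `0 ≤ U − V₁|t⊥| − V₂|t⊥'|`,
`0 < ρ < 2` and unit rows `(a₁, b₁)` at `V₁`, `(a₂, b₂)` at `V₂`:
`energyDensityTT' t t' (U − V₁|t⊥| − V₂|t⊥'|) ρ + |t⊥|·(a₁/2 + b₁ρ) + |t⊥'|·(a₂/2 + b₂ρ) ≤ inf_{periodic, filling ρ} e(bilayer crystal)`.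
[cite: Anderson1951, eq. (2)] -/
theorem le_infCellEnergyOn_bilayerHubbardTTPrime_twoDimer_unitRows (t t' : ℝ) {U V₁ V₂ : ℝ} (tperp tperp' : ℝ)
    (hUW : 0 ≤ U - V₁ * |tperp| - V₂ * |tperp'|) {ρ : ℝ} (hρ0 : 0 < ρ) (hρ2 : ρ < 2) {a₁ b₁ a₂ b₂ : ℝ}
    (hrow₁ : ∀ k : ℕ, k ≤ 4 → a₁ + b₁ * k ≤ groundEnergy (hubbardOpenBoxTT' 2 1 1 0 V₁) k)
    (hrow₂ : ∀ k : ℕ, k ≤ 4 → a₂ + b₂ * k ≤ groundEnergy (hubbardOpenBoxTT' 2 1 1 0 V₂) k) :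
    energyDensityTT' t t' (U - V₁ * |tperp| - V₂ * |tperp'|) ρ + |tperp| * (2⁻¹ * (a₁ + 2 * b₁ * ρ)) +
        |tperp'| * (2⁻¹ * (a₂ + 2 * b₂ * ρ)) ≤
      infCellEnergyOn (periodicStatesAt (stackPeriods 2 1) ρ)
        (periodicLayeredHubbardTTPrimeViews 1 t t' U (fun _ : Fin 1 => (unitVec (0 : Fin 3) : Site 3))
          fun j _ => ![tperp, tperp'] j) 1 := by
  have h := le_infCellEnergyOn_bilayerHubbardTTPrime_twoDimer_openBox t t' (W₁ := V₁ * |tperp|) (W₂ := V₂ * |tperp'|)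
    hUW hρ0 hρ2 tperp tperp' (a₁ := |tperp| * a₁) (b₁ := |tperp| * b₁) (a₂ := |tperp'| * a₂) (b₂ := |tperp'| * b₂)
    (fun k hk => by have h' := dimer_rows_abs tperp hrow₁ k hk; rwa [mul_comm |tperp| V₁] at h')
    (fun k hk => by have h' := dimer_rows_abs tperp' hrow₂ k hk; rwa [mul_comm |tperp'| V₂] at h')
  have hlin : |tperp| * (2⁻¹ * (a₁ + 2 * b₁ * ρ)) + |tperp'| * (2⁻¹ * (a₂ + 2 * b₂ * ρ)) =
      2⁻¹ * (|tperp| * a₁ + 2 * (|tperp| * b₁) * ρ) + 2⁻¹ * (|tperp'| * a₂ + 2 * (|tperp'| * b₂) * ρ) := by ring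
  rw [add_assoc, hlin, ← add_assoc]
  exact h

end Floor

end Literature.MathematicalPhysics.QuantumLattice

end
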